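import Summits.SmoothPoincare4.SmoothPoincare4.Theorems.ConvexBisectionAcyclicBisectionExistsHurwitzMoveClasses
import HarnessLib

/-!
# N1-move, piece (e), extended-page form: free seam transport of loops on a `w`-ray preserves the shadow
(wave 7, brick of stub `stub_M2geo` = node N1 of NF4 ▸ `node_N1_move` ▸ piece (e) / first step of the bridge
(e×) of the contract `node_N1_move ⇐ (c₁) ∧ (c₂) ∧ (d) ∧ (e)` (`N1_Move_Design.lean`, H7), line
`modp-braid-orbits`, crux `ConvexBisection.AcyclicBisectionExists`, item stmt-SmoothPoincare4-10508;
registered sub-goal `helper_shadow_seamTransport_free_ray`)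

Sequel of `…HurwitzMoveClasses.lean` (`shadow_seamTransport_free`: the loop `L` in a FLAT page).  The
bridge (e×) from H4's belt chart to the shadow-level monodromy splits a transport through `Ψ` at
intermediate angles; the intermediate loops, read back on the base from `Ψ`, lie on the right `w`-RAY
(`w ∈ ℝ_{>0} c`) but need not be flat.  This file re-proves the free transport for such loops:
`mem_range_jA_of_rotate_ray`, **`shadow_seamTransport_free_ray`** (registered
`helper_shadow_seamTransport_free_ray`) — same proof, the page clause `w (L θ) = c₀ / 2` replaced by
`w (L θ) = r · c₀`, `r > 0`.  Everything is proved; no definitions, no named facts, no `sorry`.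
Reference: R. E. Gompf, A. I. Stipsicz, *4-Manifolds and Kirby Calculus* (1999), §8.2 [GompfStipsicz1999].
-/

noncomputable section

set_option linter.dupNamespace false

open scoped Manifold ContDiff Topology Real
open Set Function

namespace Summit.SmoothPoincare4.SmoothPoincare4.Theorems.AcyclicBisectionExists.ModpBraidOrbits

open Literature.GroupTheory.CombinatorialGroupTheory.SignedHurwitz
open Literature.Topology.FourManifolds Literature.Topology.FourManifolds.LefschetzBase
open Literature.Topology.FourManifolds.HandleAttachingMap
open HurwitzMoveClasses

namespace HurwitzMoveClassesRay

section Free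

variable {g n : ℕ} {X₀ : Type} [TopologicalSpace X₀] [ChartedSpace (EuclideanHalfSpace 4) X₀]
  (bX : BoundaryData (𝓡∂ 4) X₀ (𝓡 3)) (Ψ : bX.carrier ≃ₘ⟮𝓡 3, 𝓡 3⟯ (bBase g).carrier)
  {X : Type} [TopologicalSpace X] [ChartedSpace (EuclideanHalfSpace 4) X]
  (G₀ : X₀ ≃ₘ⟮𝓡∂ 4, 𝓡∂ 4⟯ X)
  {h : Fin n → HandleAttachingMap 3 2 (Base g)} (D : MultiAttachmentData h (𝓡∂ 4) X)
  {d : Fin n → ℂ}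

/-- **A seam point on a ray, rotated within a belt-free arc, stays a seam point.**  If `G₀ (bX.incl y) =
D.jA a` with `w a` on the ray `ℝ_{>0} c₀` (extended page), `z` is the boundary point with
`Ψ z = R_τ (Ψ y)` (`R` the rigid rotation), and no belt direction `d k` equals `c₀ e^{iτ}`, then
`G₀ (bX.incl z)` lies in `range D.jA`. [cite: GompfStipsicz1999, §8.2] -/
theorem mem_range_jA_of_rotate_ray (hd : ∀ k, ‖d k‖ = 1)
    (hseam : ∀ (y : bX.carrier) (a : ↥(coresComplement h)), G₀ (bX.incl y) = D.jA a →
      ∃ c : ℝ, 0 < c ∧ w g ((bBase g).incl (Ψ y)).1 = (c : ℂ) * w g (a : Base g).1)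
    (hbelt : ∀ (y : bX.carrier) (k : Fin n) (b : ↥(beltPiece 3 2)), G₀ (bX.incl y) = D.jB k b →
      G₀ (bX.incl y) ∉ range D.jA →
      ∃ c : ℝ, 0 < c ∧ w g ((bBase g).incl (Ψ y)).1 = (c : ℂ) * d k)
    (R : AmbientIsotopy (𝓡∂ 4) (Base g))
    (hRw : ∀ (t : ℝ) (x : Base g), w g (R.toFun t x).1 = Complex.exp ((t : ℂ) * Complex.I) * w g x.1)
    {c₀ : ℂ} (hc₀ : ‖c₀‖ = 1) {τ : ℝ}
    (hfree : ∀ k, d k ≠ c₀ * Complex.exp ((τ : ℂ) * Complex.I))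
    {y z : bX.carrier} {a : ↥(coresComplement h)} (hy : G₀ (bX.incl y) = D.jA a)
    (ha : ∃ r : ℝ, 0 < r ∧ w g (a : Base g).1 = (r : ℂ) * c₀)
    (hz : (bBase g).incl (Ψ z) = R.toFun τ ((bBase g).incl (Ψ y))) :
    G₀ (bX.incl z) ∈ range D.jA := by
  obtain ⟨r, hr, hwr⟩ := ha
  by_contra hnot
  have hcov : G₀ (bX.incl z) ∈ range D.jA ∪ ⋃ k, range (D.jB k) := by
    rw [D.cover]; exact mem_univ _
  rcases hcov with hA | hB
  · exact hnot hA
  obtain ⟨k, b, hb⟩ : ∃ (k : Fin n) (b : ↥(beltPiece 3 2)), D.jB k b = G₀ (bX.incl z) := by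
    simpa only [mem_iUnion, mem_range] using hB
  obtain ⟨c, hc, hcw⟩ := hbelt z k b hb.symm hnot
  obtain ⟨c', hc', hcw'⟩ := hseam y a hy
  rw [hz, hRw, hcw', hwr] at hcw
  have e : (c : ℂ) * d k = ((c' * r : ℝ) : ℂ) * (c₀ * Complex.exp ((τ : ℂ) * Complex.I)) := by
    rw [← hcw]; push_cast; ring
  have hu' : ‖c₀ * Complex.exp ((τ : ℂ) * Complex.I)‖ = 1 := by
    rw [norm_mul, hc₀, Complex.norm_exp_ofReal_mul_I, mul_one]
  -- compare norms: the two positive factors agree, hence the unit directions agree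
  have hc2 : 0 < c' * r := mul_pos hc' hr
  have hn : c = c' * r := by
    have hn := congrArg (fun z : ℂ => ‖z‖) e
    simp only [norm_mul, Complex.norm_real, Real.norm_eq_abs, abs_of_pos hc, hd k, hu', mul_one] at hn
    rw [hn, abs_of_pos hc', abs_of_pos hr]
  rw [hn] at e
  have hc0 : ((c' * r : ℝ) : ℂ) ≠ 0 := by exact_mod_cast hc2.ne'
  exact hfree k (mul_left_cancel₀ hc0 e)

/-- **Free seam transport preserves the shadow, EXTENDED-PAGE form** (the loop `L` may leave the flat
part: `w (L θ) ∈ ℝ_{>0} c₀` only — the form step (2) of the bridge (e×) needs, where intermediate loops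
are read back from `Ψ` and need not be flat).  Data: the
fibred datum `(X₀, bX, Ψ, X, G₀, h, D)` with unit belt directions `d`, the seam clause and the belt
clause through `G₀`; the rigid page rotation `R` (`rho ∘ R_t = rho`, `w ∘ R_t = e^{it} w`); a unit
direction `c₀` and an angle `T` such that no `d k` lies on the closed arc `c₀ e^{itT}`,
`t ∈ [0, 1]`; a loop `L` in `page g c₀` presented by seam points (`G₀ (bX.incl (y θ)) = D.jA (a θ)`,
`a θ = L θ`) and the loop `L'` presented by the transported points
(`Ψ (y' θ) = R_T (Ψ (y θ))`, `G₀ (bX.incl (y' θ)) = D.jA (a' θ)`, `a' θ = L' θ`).  Then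
`shadow L' = shadow L`: the loops `t ↦ jA⁻¹ (G₀ (bX.incl (Ψ⁻¹ (R_{tT} (Ψ (y θ))))))` are a homotopy
(all transported points are seam points, `mem_range_jA_of_rotate`). [cite: GompfStipsicz1999, §8.2] -/
theorem shadow_seamTransport_free_ray (hd : ∀ k, ‖d k‖ = 1)
    (hseam : ∀ (y : bX.carrier) (a : ↥(coresComplement h)), G₀ (bX.incl y) = D.jA a →
      ∃ c : ℝ, 0 < c ∧ w g ((bBase g).incl (Ψ y)).1 = (c : ℂ) * w g (a : Base g).1)
    (hbelt : ∀ (y : bX.carrier) (k : Fin n) (b : ↥(beltPiece 3 2)), G₀ (bX.incl y) = D.jB k b →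
      G₀ (bX.incl y) ∉ range D.jA →
      ∃ c : ℝ, 0 < c ∧ w g ((bBase g).incl (Ψ y)).1 = (c : ℂ) * d k)
    (R : AmbientIsotopy (𝓡∂ 4) (Base g))
    (hRρ : ∀ (t : ℝ) (x : Base g), rho g (R.toFun t x).1 = rho g x.1)
    (hRw : ∀ (t : ℝ) (x : Base g), w g (R.toFun t x).1 = Complex.exp ((t : ℂ) * Complex.I) * w g x.1)
    {c₀ : ℂ} (hc₀ : ‖c₀‖ = 1) (T : ℝ)
    (hfree : ∀ k, ∀ t ∈ Icc (0 : ℝ) 1, d k ≠ c₀ * Complex.exp (((t * T : ℝ) : ℂ) * Complex.I))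
    {L L' : Metric.sphere (0 : EuclideanSpace ℝ (Fin 2)) 1 → Base g} (hL : Continuous L)
    (hL' : Continuous L') {y y' : Metric.sphere (0 : EuclideanSpace ℝ (Fin 2)) 1 → bX.carrier}
    {a a' : Metric.sphere (0 : EuclideanSpace ℝ (Fin 2)) 1 → ↥(coresComplement h)}
    (hLr : ∀ θ, ∃ r : ℝ, 0 < r ∧ w g (L θ).1 = (r : ℂ) * c₀) (hy : ∀ θ, G₀ (bX.incl (y θ)) = D.jA (a θ))
    (ha : ∀ θ, ((a θ : ↥(coresComplement h)) : Base g) = L θ)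
    (hrel : ∀ θ, (bBase g).incl (Ψ (y' θ)) = R.toFun T ((bBase g).incl (Ψ (y θ))))
    (hy' : ∀ θ, G₀ (bX.incl (y' θ)) = D.jA (a' θ))
    (ha' : ∀ θ, ((a' θ : ↥(coresComplement h)) : Base g) = L' θ) :
    shadow g L' hL' = shadow g L hL := by
  classical
  -- a base point of the circle, for the `Nonempty` instances of the inverse functions
  have θ₀ : Metric.sphere (0 : EuclideanSpace ℝ (Fin 2)) 1 := circlePt 0
  haveI : Nonempty bX.carrier := ⟨y θ₀⟩
  haveI : Nonempty ↥(coresComplement h) := ⟨a θ₀⟩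
  haveI : Nonempty (bBase g).carrier := ⟨Ψ (y θ₀)⟩
  -- the embeddings and their inverses
  have hincl : Topology.IsEmbedding (bBase g).incl := (bBase g).isSmoothEmbedding.isEmbedding
  have hGi : Topology.IsEmbedding (fun x : bX.carrier => G₀ (bX.incl x)) :=
    G₀.toHomeomorph.isEmbedding.comp bX.isSmoothEmbedding.isEmbedding
  have hjA : Topology.IsEmbedding D.jA := D.hjA.isEmbedding
  set iB : Base g → (bBase g).carrier := Function.invFun (bBase g).incl with hiB
  set iA : X → ↥(coresComplement h) := Function.invFun D.jA with hiA
  set iG : X → bX.carrier := Function.invFun (fun x : bX.carrier => G₀ (bX.incl x)) with hiG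
  have hiBc : ContinuousOn iB (range (bBase g).incl) := continuousOn_invFun_range hincl
  have hiAc : ContinuousOn iA (range D.jA) := continuousOn_invFun_range hjA
  have hiGc : ContinuousOn iG (range fun x : bX.carrier => G₀ (bX.incl x)) :=
    continuousOn_invFun_range hGi
  -- `y` is continuous: it is `(G₀ ∘ incl)⁻¹ ∘ jA ∘ a`
  have hac : Continuous a := by
    have : Continuous fun θ => ((a θ : ↥(coresComplement h)) : Base g) := by
      simp_rw [ha]; exact hL
    exact continuous_induced_rng.2 this
  have hyc : Continuous y := by
    have e : y = fun θ => iG (D.jA (a θ)) := by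
      funext θ; rw [← hy θ, hiG, invFun_apply hGi.injective]
    rw [e]
    refine hiGc.comp_continuous (D.hjA.isEmbedding.continuous.comp hac) fun θ => ?_
    exact ⟨y θ, hy θ⟩
  -- the rotated boundary points `ζ t θ`, `incl (ζ t θ) = R_{tT} (incl (Ψ (y θ)))`
  set zB : ℝ → Metric.sphere (0 : EuclideanSpace ℝ (Fin 2)) 1 → Base g :=
    fun t θ => R.toFun (t * T) ((bBase g).incl (Ψ (y θ))) with hzB
  have hzBmem : ∀ t θ, zB t θ ∈ range (bBase g).incl := by
    intro t θ
    rw [(bBase g).range_incl, RegularSublevel.mem_boundary_iff]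
    show rho g (R.toFun (t * T) ((bBase g).incl (Ψ (y θ)))).1 = 1 / 4
    rw [hRρ]
    exact (RegularSublevel.mem_boundary_iff (isRegularLevel_rho g) _).1
      ((bBase g).incl_mem_boundary _)
  have hzBincl : ∀ t θ, (bBase g).incl (iB (zB t θ)) = zB t θ := fun t θ =>
    Function.invFun_eq (hzBmem t θ)
  have hzBc : Continuous (uncurry zB) := by
    have hRc : Continuous (uncurry R.toFun) := R.contMDiff.continuous
    exact hRc.comp (((continuous_fst.mul continuous_const)).prodMk
      ((bBase g).continuous_incl.comp (Ψ.continuous.comp (hyc.comp continuous_snd))))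
  -- the transported points of `X`
  set q : ℝ → Metric.sphere (0 : EuclideanSpace ℝ (Fin 2)) 1 → X :=
    fun t θ => G₀ (bX.incl (Ψ.symm (iB (zB t θ)))) with hq
  have hqc : Continuous (uncurry q) := by
    have h1 : Continuous fun p : ℝ × Metric.sphere (0 : EuclideanSpace ℝ (Fin 2)) 1 =>
        iB (zB p.1 p.2) :=
      hiBc.comp_continuous hzBc fun p => hzBmem p.1 p.2
    exact G₀.continuous.comp (bX.continuous_incl.comp (Ψ.symm.continuous.comp h1))
  have hqmem : ∀ t ∈ Icc (0 : ℝ) 1, ∀ θ, q t θ ∈ range D.jA := by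
    intro t ht θ
    refine mem_range_jA_of_rotate_ray bX Ψ G₀ D hd hseam hbelt R hRw hc₀ (τ := t * T)
      (fun k => ?_) (hy θ) ((ha θ).symm ▸ hLr θ) ?_
    · have := hfree k t ht; push_cast at this ⊢; exact this
    · show (bBase g).incl (Ψ (Ψ.symm (iB (zB t θ)))) = R.toFun (t * T) ((bBase g).incl (Ψ (y θ)))
      rw [Diffeomorph.apply_symm_apply, hzBincl]
  -- the homotopy of base loops
  set H : ℝ → Metric.sphere (0 : EuclideanSpace ℝ (Fin 2)) 1 → Base g :=
    fun t θ => ((iA (q t θ) : ↥(coresComplement h)) : Base g) with hH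
  have hHc : ContinuousOn (uncurry H) (Icc (0 : ℝ) 1 ×ˢ univ) := by
    have h1 : ContinuousOn (fun p : ℝ × Metric.sphere (0 : EuclideanSpace ℝ (Fin 2)) 1 =>
        iA (q p.1 p.2)) (Icc (0 : ℝ) 1 ×ˢ univ) :=
      hiAc.comp hqc.continuousOn fun p hp => hqmem p.1 hp.1 p.2
    exact continuous_subtype_val.comp_continuousOn h1
  -- end points
  have hq0 : ∀ θ, q 0 θ = D.jA (a θ) := by
    intro θ
    have e : iB (zB 0 θ) = Ψ (y θ) := by
      apply (bBase g).injective_incl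
      rw [hzBincl]
      show R.toFun (0 * T) ((bBase g).incl (Ψ (y θ))) = _
      rw [zero_mul, R.map_zero]; rfl
    show G₀ (bX.incl (Ψ.symm (iB (zB 0 θ)))) = D.jA (a θ)
    rw [e, Diffeomorph.symm_apply_apply, hy]
  have hq1 : ∀ θ, q 1 θ = D.jA (a' θ) := by
    intro θ
    have e : iB (zB 1 θ) = Ψ (y' θ) := by
      apply (bBase g).injective_incl
      rw [hzBincl, hrel]
      show R.toFun (1 * T) ((bBase g).incl (Ψ (y θ))) = _
      rw [one_mul]
    show G₀ (bX.incl (Ψ.symm (iB (zB 1 θ)))) = D.jA (a' θ)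
    rw [e, Diffeomorph.symm_apply_apply, hy']
  have hH0 : ∀ θ, H 0 θ = L θ := fun θ => by
    show ((iA (q 0 θ) : ↥(coresComplement h)) : Base g) = L θ
    rw [hq0, hiA, invFun_apply hjA.injective, ha]
  have hH1 : ∀ θ, H 1 θ = L' θ := fun θ => by
    show ((iA (q 1 θ) : ↥(coresComplement h)) : Base g) = L' θ
    rw [hq1, hiA, invFun_apply hjA.injective, ha']
  exact (shadow_eq_of_family H hHc hL hL' hH0 hH1).symm

end Free


end HurwitzMoveClassesRay

open HurwitzMoveClassesRay

/-! ## The registered form -/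

/-- **Sub-goal `helper_shadow_seamTransport_free_ray`** (fully qualified): free seam transport of a loop on
a `w`-ray preserves the shadow — see `shadow_seamTransport_free_ray`. [cite: GompfStipsicz1999, §8.2] -/
theorem helper_shadow_seamTransport_free_ray : ∀ (g n : ℕ) (X₀ : Type) [TopologicalSpace X₀] [ChartedSpace (EuclideanHalfSpace 4) X₀] (bX : Literature.Topology.FourManifolds.BoundaryData (𝓡∂ 4) X₀ (𝓡 3)) (Ψ : bX.carrier ≃ₘ⟮𝓡 3, 𝓡 3⟯ (Literature.Topology.FourManifolds.LefschetzBase.bBase g).carrier) (X : Type) [TopologicalSpace X] [ChartedSpace (EuclideanHalfSpace 4) X] (G₀ : X₀ ≃ₘ⟮𝓡∂ 4, 𝓡∂ 4⟯ X) (h : Fin n → Literature.Topology.FourManifolds.HandleAttachingMap 3 2 (Literature.Topology.FourManifolds.LefschetzBase.Base g)) (D : Literature.Topology.FourManifolds.HandleAttachingMap.MultiAttachmentData h (𝓡∂ 4) X) (d : Fin n → ℂ), (∀ k, ‖d k‖ = 1) → (∀ (y : bX.carrier) (a : ↥(Literature.Topology.FourManifolds.HandleAttachingMap.coresComplement h)),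 G₀ (bX.incl y) = D.jA a → ∃ c : ℝ, 0 < c ∧ Literature.Topology.FourManifolds.LefschetzBase.w g ((Literature.Topology.FourManifolds.LefschetzBase.bBase g).incl (Ψ y)).1 = (c : ℂ) * Literature.Topology.FourManifolds.LefschetzBase.w g (a : Literature.Topology.FourManifolds.LefschetzBase.Base g).1) → (∀ (y : bX.carrier) (k : Fin n) (b : ↥(Literature.Topology.FourManifolds.beltPiece 3 2)), G₀ (bX.incl y) = D.jB k b → G₀ (bX.incl y) ∉ Set.range D.jA → ∃ c : ℝ, 0 < c ∧ Literature.Topology.FourManifolds.LefschetzBase.w g ((Literature.Topology.FourManifolds.LefschetzBase.bBase g).incl (Ψ y)).1 = (c : ℂ) * d k) → ∀ (R : Literature.Topology.FourManifolds.AmbientIsotopy (𝓡∂ 4) (Literature.Topology.FourManifolds.LefschetzBase.Base g)), (∀ (t : ℝ) (x : Literature.Topology.FourManifolds.LefschetzBase.Base g), Literature.Topology.FourManifolds.LefschetzBase.rho g (R.toFun t x).1 = Literature.Topology.FourManifolds.LefschetzBase.rho g x.1) → (∀ (t : ℝ) (x : Literature.Topology.FourManifolds.LefschetzBase.Base g),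 Literature.Topology.FourManifolds.LefschetzBase.w g (R.toFun t x).1 = Complex.exp ((t : ℂ) * Complex.I) * Literature.Topology.FourManifolds.LefschetzBase.w g x.1) → ∀ (c₀ : ℂ) (T : ℝ), ‖c₀‖ = 1 → (∀ (k : Fin n), ∀ t ∈ Set.Icc (0 : ℝ) 1, d k ≠ c₀ * Complex.exp (((t * T : ℝ) : ℂ) * Complex.I)) → ∀ (L L' : Metric.sphere (0 : EuclideanSpace ℝ (Fin 2)) 1 → Literature.Topology.FourManifolds.LefschetzBase.Base g) (hL : Continuous L) (hL' : Continuous L') (y y' : Metric.sphere (0 : EuclideanSpace ℝ (Fin 2)) 1 → bX.carrier) (a a' : Metric.sphere (0 : EuclideanSpace ℝ (Fin 2)) 1 → ↥(Literature.Topology.FourManifolds.HandleAttachingMap.coresComplement h)), (∀ θ, ∃ r : ℝ, 0 < r ∧ Literature.Topology.FourManifolds.LefschetzBase.w g (L θ).1 = (r : ℂ) * c₀) → (∀ θ, G₀ (bX.incl (y θ)) = D.jA (a θ)) → (∀ θ, ((a θ : ↥(Literature.Topology.FourManifolds.HandleAttachingMap.coresComplement h)) : Literature.Topology.FourManifolds.LefschetzBase.Base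 g) = L θ) → (∀ θ, (Literature.Topology.FourManifolds.LefschetzBase.bBase g).incl (Ψ (y' θ)) = R.toFun T ((Literature.Topology.FourManifolds.LefschetzBase.bBase g).incl (Ψ (y θ)))) → (∀ θ, G₀ (bX.incl (y' θ)) = D.jA (a' θ)) → (∀ θ, ((a' θ : ↥(Literature.Topology.FourManifolds.HandleAttachingMap.coresComplement h)) : Literature.Topology.FourManifolds.LefschetzBase.Base g) = L' θ) → Literature.Topology.FourManifolds.LefschetzBase.shadow g L' hL' = Literature.Topology.FourManifolds.LefschetzBase.shadow g L hL :=
  fun _ _ _ _ _ bX Ψ _ _ _ G₀ _ D _ hd hseam hbelt R hRρ hRw _ T hc₀ hfree _ _ hL hL' _ _ _ _ hLr hy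
      ha hrel hy' ha' =>
    shadow_seamTransport_free_ray bX Ψ G₀ D hd hseam hbelt R hRρ hRw hc₀ T hfree hL hL' hLr hy ha hrel
      hy' ha'

end Summit.SmoothPoincare4.SmoothPoincare4.Theorems.AcyclicBisectionExists.ModpBraidOrbits

end
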